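import Mathlib
import Literature.Probability.LatticeModels.LatticeGraph

/-!
# Sketch — first lemmas for the crux-idea cards on `NodalWardXY.PerturbedXYOrder`
(stmt-HubbardSuperconductivity-10739; crux-ideate round 1, ideator 1).

Vocabulary is literally the crux's: angles `θ : TorusSite 3 L → ℝ` on the cube `[0,2π]^Λ` with product
Lebesgue measure, directed bonds `b = (x,i)`, `∇_b θ = θ (x + eᵢ) - θ x`, current `j_b = sin ∇_b θ`,
weight `w_J = exp (J Σ_b cos ∇_b θ)`.

* `CurrentRepresentation`  — first lemma of card A (villain-unfold-dipole-rg): the abelian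
  character expansion with an arbitrary COMPLEX linear current source `A : bonds → ℂ`
  (the two-current tilt enters through `∂²/∂A∂A'` / Gaussian averaging in `A`).
* `GaugeShiftIdentity`     — first lemma of card B (ward-longitudinal-gauge): the exponentiated
  lattice Ward identity: a source of pure-gauge form `A_b = J sin ∇_b c` is removed exactly by the
  shift `θ ↦ θ + c`, at the price of the local even stiffness change `J ↦ J cos ∇_b c`.
* `WardIdentity`           — its infinitesimal form `E_J[div j (x) · G] = -(1/J) E_J[∂_{θ_x} G]`.
Nothing here is proved; the defs only fix checkable signatures.
-/

open MeasureTheory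
open scoped BigOperators

namespace Summit.HubbardSuperconductivity.HubbardSuperconductivity.Cruxes.PerturbedXYOrder.Sketch

open Literature.Probability.LatticeModels

/-- directed bonds `(x, i)` of the 3-torus of side `L`. -/
abbrev Bond (L : ℕ) : Type := TorusSite 3 L × Fin 3
/-- angle configurations. -/
abbrev Cfg (L : ℕ) : Type := TorusSite 3 L → ℝ

/-- the cube `[0,2π]^Λ` (verbatim the crux's `cube`). -/
def cube (L : ℕ) : Set (Cfg L) := Set.pi Set.univ (fun _ => Set.Icc (0:ℝ) (2 * Real.pi))

/-- discrete gradient along a directed bond (verbatim the argument of the crux's `cur`). -/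
def grad {L : ℕ} (θ : Cfg L) (b : Bond L) : ℝ := θ (b.1 + Pi.single b.2 1) - θ b.1

/-- the rotator weight `w_J(θ) = exp (J Σ_b cos ∇_b θ)` as a complex number (verbatim the crux's `wJ`). -/
noncomputable def wJ {L : ℕ} [NeZero L] (J : ℝ) (θ : Cfg L) : ℂ :=
  ((Real.exp (J * ∑ b : Bond L, Real.cos (grad θ b)) : ℝ) : ℂ)

/-- lattice divergence (outflow minus inflow) of an integer bond field at a site. -/
def divZ {L : ℕ} (n : Bond L → ℤ) (x : TorusSite 3 L) : ℤ :=
  ∑ i : Fin 3, (n (x, i) - n (x - Pi.single i 1, i))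

/-- lattice divergence of the real current `j_b = sin ∇_b θ` at a site. -/
noncomputable def divCur {L : ℕ} (θ : Cfg L) (x : TorusSite 3 L) : ℝ :=
  ∑ i : Fin 3, (Real.sin (grad θ (x, i)) - Real.sin (grad θ (x - Pi.single i 1, i)))

/-- complex single-bond Fourier–Bessel coefficient
`c_n(J,a) = (2π)⁻¹ ∫_0^{2π} exp (J cos v + a sin v) e^{-inv} dv` (for real `a`: `e^{-inα} I_n(√(J²+a²))`,
`tan α = a/J`; entire in `a`). -/
noncomputable def bondCoeff (J : ℝ) (a : ℂ) (n : ℤ) : ℂ :=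
  (1 / (2 * Real.pi) : ℂ) *
    ∫ v in Set.Icc (0:ℝ) (2 * Real.pi),
      Complex.exp (((J * Real.cos v : ℝ) : ℂ) + a * ((Real.sin v : ℝ) : ℂ)) *
        Complex.exp (-(Complex.I * (n : ℂ) * ((v : ℝ) : ℂ)))

/-- **First lemma of card A (complex-source current representation).** For every complex linear
current source `A : bonds → ℂ`,
`∫_cube exp (Σ_b [J cos ∇_bθ + A_b sin ∇_bθ]) dθ = (2π)^{|Λ|} Σ_{n : bonds → ℤ, div n = 0} ∏_b c_{n_b}(J, A_b)`:
the source couples to the INTEGER CURRENT `n` only through the bond coefficients, so after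
`n = curl a` (+ Poisson) it becomes a complex shift of the dual Gaussian / loop data. Exact for every
`L ≥ 2` (pure Fourier orthogonality on the torus; absolute convergence from entire bond weights). -/
def CurrentRepresentation : Prop :=
  ∀ (L : ℕ) [NeZero L], 2 ≤ L → ∀ (J : ℝ) (A : Bond L → ℂ),
    MeasureTheory.integral (volume.restrict (cube L))
        (fun θ => Complex.exp (∑ b : Bond L,
          ((((J * Real.cos (grad θ b)) : ℝ) : ℂ) + A b * ((Real.sin (grad θ b) : ℝ) : ℂ))))
      = ((2 * Real.pi : ℝ) : ℂ) ^ (Fintype.card (TorusSite 3 L)) *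
        ∑' n : Bond L → ℤ, (if (∀ x, divZ n x = 0) then ∏ b : Bond L, bondCoeff J (A b) (n b) else 0)

/-- **First lemma of card B (exponentiated Ward identity / gauge shift).** For every real site field
`c` and every continuous `2π`-periodic observable `G`,
`∫_cube G(θ) exp (J Σ_b [cos ∇_b c · cos ∇_bθ + sin ∇_b c · sin ∇_bθ]) dθ = ∫_cube G(θ + c) w_J(θ) dθ`,
i.e. the linear current source `A_b = J sin ∇_b c` is pure gauge modulo the local even stiffness
change `J ↦ J cos ∇_b c = J - (∇_b(Jc))²/(2J) + …`. (Proof: `cos ∇(θ - c)` expanded, then the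
translation `θ ↦ θ + c` of the torus. Both sides are entire in `c`, so for entire `G` the identity
persists for COMPLEX `c` — the contour-deformation form used by the card.) -/
def GaugeShiftIdentity : Prop :=
  ∀ (L : ℕ) [NeZero L] (J : ℝ) (c : Cfg L) (G : Cfg L → ℂ),
    Continuous G →
    (∀ (θ : Cfg L) (x : TorusSite 3 L) (k : ℤ),
        G (θ + fun y => if y = x then 2 * Real.pi * k else 0) = G θ) →
    MeasureTheory.integral (volume.restrict (cube L))
        (fun θ => G θ * Complex.exp (∑ b : Bond L,
          (((J * Real.cos (grad c b) * Real.cos (grad θ b)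
              + J * Real.sin (grad c b) * Real.sin (grad θ b)) : ℝ) : ℂ)))
      = MeasureTheory.integral (volume.restrict (cube L)) (fun θ => G (θ + c) * wJ J θ)

/-- **Infinitesimal form (lattice Ward identity for the rotator current).** With
`div j (x) = Σ_i [sin ∇_{(x,i)}θ - sin ∇_{(x-eᵢ,i)}θ]` one has `∂_{θ_x}(-J Σ_b cos ∇_bθ) = -J div j (x)`,
hence for `J ≠ 0` and every periodic `C¹` observable `G` with partial derivative `dG` in the direction
`θ_x`: `∫_cube div j (x) · G · w_J = -(1/J) ∫_cube dG · w_J` — insertions of the DIVERGENCE of the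
Noether current cost a factor `1/J` (or act as `∂/∂θ`); valid verbatim under any complex tilt
`G ↦ G e^{W_K}`. -/
def WardIdentity : Prop :=
  ∀ (L : ℕ) [NeZero L] (J : ℝ), J ≠ 0 → ∀ (x : TorusSite 3 L) (G dG : Cfg L → ℂ),
    Continuous G → Continuous dG →
    (∀ (θ : Cfg L) (y : TorusSite 3 L) (k : ℤ),
        G (θ + fun z => if z = y then 2 * Real.pi * k else 0) = G θ) →
    (∀ θ : Cfg L, HasDerivAt (fun t : ℝ => G (θ + fun z => if z = x then t else 0)) (dG θ) 0) →
    MeasureTheory.integral (volume.restrict (cube L))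
        (fun θ => ((divCur θ x : ℝ) : ℂ) * G θ * wJ J θ)
      = -(1 / (J : ℂ)) * MeasureTheory.integral (volume.restrict (cube L)) (fun θ => dG θ * wJ J θ)

end Summit.HubbardSuperconductivity.HubbardSuperconductivity.Cruxes.PerturbedXYOrder.Sketch
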